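import Summits.SmoothPoincare4.SmoothPoincare4.Theses.EntropyRung
import Summits.SmoothPoincare4.SmoothPoincare4.Theorems.EntropyRungSubcylindricalExistenceWeightComparison
import Literature.Geometry.Riemannian.PerelmanEntropyCutoff
import Literature.Geometry.Riemannian.BakryEmeryHeatFlow
import Literature.Geometry.Lorentzian.ChartLaplacian
import Literature.Geometry.Lorentzian.CurvatureSymmetries
import HarnessLib

/-!
# The core comparison of the round-capped blow-up (line `green-blowup-conformal-entropy`,
# crux `EntropyRung.SubcylindricalExistence`, stmt-SmoothPoincare4-10871; helper for Stub D)

For Green data `(g, p, G)` whose blow-up `h = G² g` satisfies the `w²`-clause at level `L`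
(test functions vanishing near `p`, all scales), and the round cap factor `ψ = 4KG/(4K+G)` off `p`
with `L_g ψ > 0`, the `ψ`-weighted clause holds on the CORE `U_S = {x ≠ p, G x < S}` at level
`L + 2 log(1−ε) − 8κ − 16 τ e^{2κ} κ'²/ε`, `κ = log(1 + S/4K)`, `κ'² = Λ/(16K²)`, where
`Λ ≥ sup_{U_S} G⁻²|∇G|²_g`: this is the landed weight-comparison lemma H3
(`wClause_weight_comparison`, p107145) with `φ₀ = G`, `φ₁ = ψ`, `r₀ = 0`, `r₁ = ψ⁻³ L_g ψ`,
`κ'' = 0` — on `U_S`, `ψ/G = 4K/(4K+G) ∈ [4K/(4K+S), 1]` and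
`G⁻²|∇ log(ψ/G)|² = G⁻²|∇G|²/(4K+G)² ≤ Λ/(16K²)`. As `K → ∞` (fixed `S`, `τ = O(K)`) the level tends
to `L + 2 log(1 − ε)`. Everything is proved; no definitions, no named facts.
-/

noncomputable section

set_option linter.dupNamespace false

open scoped Manifold ContDiff Topology
open Set Filter MeasureTheory
open Literature.Geometry.Lorentzian

namespace Summit.SmoothPoincare4.SmoothPoincare4.Theorems

namespace GluingCore

variable {M : Type} [TopologicalSpace M] [T2Space M] [SecondCountableTopology M]
  [ChartedSpace (EuclideanSpace ℝ (Fin 4)) M] [IsManifold (𝓡 4) ∞ M] [CompactSpace M]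
  [T3Space M] [MeasurableSpace M] [BorelSpace M]
  (g : PseudoRiemannianMetric (𝓡 4) ∞ (EuclideanSpace ℝ (Fin 4)) (TangentSpace (𝓡 4) : M → Type _))

omit [T2Space M] [SecondCountableTopology M] [CompactSpace M] [T3Space M] [MeasurableSpace M]
  [BorelSpace M] in
/-- The gradient square is local: functions agreeing near `x` have the same `|∇·|²_g (x)`. [folklore] -/
theorem gradSq_congr_of_eventuallyEq {f f' : M → ℝ} {x : M} (h : f =ᶠ[𝓝 x] f') :
    g.gradSq f x = g.gradSq f' x := by
  simp only [PseudoRiemannianMetric.gradSq, mvfderiv_congr_of_eventuallyEq h]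

omit [T2Space M] [SecondCountableTopology M] [CompactSpace M] [T3Space M] [MeasurableSpace M]
  [BorelSpace M] in
/-- `|∇ log(4K/(4K+G))|²_g = (4K+G)⁻² |∇G|²_g` where `G` is differentiable and `4K + G > 0`. [folklore] -/
theorem gradSq_log_ratio {G : M → ℝ} {K : ℝ} {x : M} (hK : 0 < K) (hGx : 0 < G x)
    (hG : MDifferentiableAt (𝓡 4) 𝓘(ℝ, ℝ) G x) :
    g.gradSq (fun y ↦ Real.log (4 * K / (4 * K + G y))) x = (4 * K + G x)⁻¹ ^ 2 * g.gradSq G x := by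
  have hpos : 0 < 4 * K + G x := by positivity
  -- `log(4K/(4K+G)) = log 4K − log(4K + G)` near `x`
  have hev : (fun y ↦ Real.log (4 * K / (4 * K + G y))) =ᶠ[𝓝 x]
      fun y ↦ Real.log (4 * K) - Real.log (4 * K + G y) := by
    have hc : ContinuousAt (fun y ↦ 4 * K + G y) x := continuousAt_const.add hG.continuousAt
    have hev' : ∀ᶠ y in 𝓝 x, 0 < 4 * K + G y := hc.eventually (lt_mem_nhds hpos)
    filter_upwards [hev'] with y hy
    rw [Real.log_div (by positivity) hy.ne']
  rw [gradSq_congr_of_eventuallyEq g hev]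
  have hG' : MDifferentiableAt (𝓡 4) 𝓘(ℝ, ℝ) (fun y ↦ 4 * K + G y) x := mdifferentiableAt_const.add hG
  rw [g.gradSq_const_sub_log_comp (Real.log (4 * K)) hpos hG']
  congr 1
  -- `|∇(4K + G)|² = |∇G|²`
  have hh : HasDerivAt (fun t : ℝ ↦ 4 * K + t) 1 (G x) := by
    simpa using (hasDerivAt_id (G x)).const_add (4 * K)
  have := g.gradSq_real_comp (h := fun t : ℝ ↦ 4 * K + t) hh hG
  rw [show (fun y ↦ 4 * K + G y) = (fun t : ℝ ↦ 4 * K + t) ∘ G from rfl, this]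
  ring

/-- **The core clause of the round-capped blow-up.** Let `G` be smooth and positive on `M ∖ {p}`,
let the blow-up `w²`-clause hold at level `L` (all scales, smooth `w` vanishing near `p`,
weights `G⁴`, `G⁻²`, no curvature term), let `ψ` be smooth with `ψ = 4KG/(4K+G)` off `p` (`K > 0`)
and `R_g ψ − 6Δ_g ψ > 0`, and let `Λ ≥ G⁻²|∇G|²_g` on `U_S = {x ≠ p, G x < S}` (`S > 0`). Then for
`0 < τ`, `0 < ε < 1` and every smooth `w` supported in `U_S` with `∫ (4πτ)⁻² w² ψ⁴ dV = 1`,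
`L + 2 log(1−ε) − 8κ − 16τe^{2κ}κ'²/ε − τ·0 ≤ ∫ [τ(ψ⁻³L_gψ w² + 4ψ⁻²|∇w|²) − w² log w² − 4w²](4πτ)⁻²ψ⁴ dV`
with `κ = log(1 + S/(4K))`, `κ' = √Λ/(4K)` (H3 `wClause_weight_comparison`). [folklore] -/
theorem coreClause [g.HasLeviCivita] (hg : g.IsRiemannian) {p : M} {G : M → ℝ}
    (hGs : ContMDiffOn (𝓡 4) 𝓘(ℝ, ℝ) ∞ G {p}ᶜ) (hGpos : ∀ x, x ≠ p → 0 < G x) {L : ℝ}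
    (hBlow : ∀ τ : ℝ, 0 < τ → ∀ w : M → ℝ, ContMDiff (𝓡 4) 𝓘(ℝ, ℝ) ∞ w → w =ᶠ[𝓝 p] 0 →
      ∫ x, (4 * Real.pi * τ) ^ (-(4 : ℝ) / 2) * (w x) ^ 2 * (G x) ^ 4
          ∂(riemannianMeasure (g.toContMDiffRiemannianMetric hg)) = 1 →
        L ≤ ∫ x, (4 * τ * ((G x)⁻¹ ^ 2 * g.gradSq w x) - (w x) ^ 2 * Real.log ((w x) ^ 2)
            - 4 * (w x) ^ 2) * ((4 * Real.pi * τ) ^ (-(4 : ℝ) / 2) * (G x) ^ 4)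
          ∂(riemannianMeasure (g.toContMDiffRiemannianMetric hg)))
    {K : ℝ} (hK : 0 < K) {ψ : M → ℝ} (hψ : ContMDiff (𝓡 4) 𝓘(ℝ, ℝ) ∞ ψ) (hψpos : ∀ x, 0 < ψ x)
    (hψG : ∀ x, x ≠ p → ψ x = 4 * K * G x / (4 * K + G x))
    (hLψ : ∀ x, 0 < g.scalarCurvature x * ψ x - 6 * g.dalembertian ψ x)
    {S Λ : ℝ} (hS : 0 < S) (hΛ0 : 0 ≤ Λ)
    (hΛ : ∀ x, x ≠ p → G x < S → (G x)⁻¹ ^ 2 * g.gradSq G x ≤ Λ) :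
    ∀ (τ ε : ℝ), 0 < τ → 0 < ε → ε < 1 →
    ∀ w : M → ℝ, ContMDiff (𝓡 4) 𝓘(ℝ, ℝ) ∞ w → tsupport w ⊆ {x | x ≠ p ∧ G x < S} →
      ∫ x, (4 * Real.pi * τ) ^ (-(4 : ℝ) / 2) * (w x) ^ 2 * (ψ x) ^ 4
          ∂(riemannianMeasure (g.toContMDiffRiemannianMetric hg)) = 1 →
        L + 2 * Real.log (1 - ε) - 8 * Real.log (1 + S / (4 * K))
            - 16 * τ * Real.exp (2 * Real.log (1 + S / (4 * K))) * (Real.sqrt Λ / (4 * K)) ^ 2 / ε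
            - τ * 0 ≤
          ∫ x, (τ * ((ψ x ^ 3)⁻¹ * (g.scalarCurvature x * ψ x - 6 * g.dalembertian ψ x) * (w x) ^ 2
                + 4 * ((ψ x)⁻¹ ^ 2 * g.gradSq w x))
              - (w x) ^ 2 * Real.log ((w x) ^ 2) - 4 * (w x) ^ 2)
              * ((4 * Real.pi * τ) ^ (-(4 : ℝ) / 2) * (ψ x) ^ 4)
            ∂(riemannianMeasure (g.toContMDiffRiemannianMetric hg)) := by
  intro τ ε hτ hε hε1 w hw hsupp hnorm
  set U : Set M := {x | x ≠ p ∧ G x < S} with hU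
  set κ : ℝ := Real.log (1 + S / (4 * K)) with hκ
  set κ' : ℝ := Real.sqrt Λ / (4 * K) with hκ'
  set r₁ : M → ℝ := fun x ↦ (ψ x ^ 3)⁻¹ * (g.scalarCurvature x * ψ x - 6 * g.dalembertian ψ x)
    with hr₁
  -- `U` is open, misses `p`
  have hGc : ContinuousOn G {p}ᶜ := hGs.continuousOn
  have hUeq : U = {p}ᶜ ∩ G ⁻¹' Iio S := by
    ext x; simp [hU]
  have hUopen : IsOpen U := by
    rw [hUeq]; exact hGc.isOpen_inter_preimage isOpen_compl_singleton isOpen_Iio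
  have hUp : ∀ x ∈ U, x ≠ p := fun x hx ↦ hx.1
  have hUS : ∀ x ∈ U, G x < S := fun x hx ↦ hx.2
  have hpU : p ∉ U := fun h ↦ h.1 rfl
  have hGd : ∀ x, x ≠ p → MDifferentiableAt (𝓡 4) 𝓘(ℝ, ℝ) G x := fun x hx ↦
    (hGs.contMDiffAt (isOpen_compl_singleton.mem_nhds hx)).mdifferentiableAt (by simp)
  -- regularity data of H3
  have hφ₀ : ContMDiffOn (𝓡 4) 𝓘(ℝ, ℝ) ∞ G U := hGs.mono fun x hx ↦ hUp x hx
  have hφ₁ : ContMDiffOn (𝓡 4) 𝓘(ℝ, ℝ) ∞ ψ U := hψ.contMDiffOn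
  have hr₀c : ContinuousOn (fun _ : M ↦ (0 : ℝ)) U := continuousOn_const
  have hψ2 : ContMDiff (𝓡 4) 𝓘(ℝ, ℝ) 2 ψ := hψ.of_le (WithTop.coe_le_coe.mpr le_top)
  have hr₁cont : Continuous r₁ := by
    have hΔ : Continuous (g.dalembertian ψ) := continuous_dalembertian g hψ2
    have hR : Continuous g.scalarCurvature := g.contMDiff_scalarCurvature.continuous
    exact ((hψ.continuous.pow 3).inv₀ fun x ↦ (pow_pos (hψpos x) 3).ne').mul
      ((hR.mul hψ.continuous).sub (continuous_const.mul hΔ))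
  have hr₁c : ContinuousOn r₁ U := hr₁cont.continuousOn
  have h0 : ∀ x ∈ U, 0 < G x := fun x hx ↦ hGpos x (hUp x hx)
  have h1 : ∀ x ∈ U, 0 < ψ x := fun x _ ↦ hψpos x
  -- the constants
  have hSK : 0 < 1 + S / (4 * K) := by positivity
  have hκ0 : 0 ≤ κ := Real.log_nonneg (by
    have : 0 ≤ S / (4 * K) := by positivity
    linarith)
  have hκ'0 : 0 ≤ κ' := by positivity
  have hexpκ : Real.exp κ = 1 + S / (4 * K) := by rw [hκ, Real.exp_log hSK]
  have hexpnκ : Real.exp (-κ) = (1 + S / (4 * K))⁻¹ := by rw [Real.exp_neg, hexpκ]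
  -- the ratio `ψ/G = 4K/(4K+G)` on `U`
  have hratioU : ∀ x ∈ U, ψ x / G x = 4 * K / (4 * K + G x) := by
    intro x hx
    have hGx := h0 x hx
    rw [hψG x (hUp x hx)]
    field_simp
  have hρ : ∀ x ∈ U, Real.exp (-κ) ≤ ψ x / G x ∧ ψ x / G x ≤ Real.exp κ := by
    intro x hx
    have hGx := h0 x hx
    have hGS := hUS x hx
    rw [hratioU x hx, hexpκ, hexpnκ]
    constructor
    · rw [inv_eq_one_div, div_le_div_iff₀ hSK (by positivity)]
      have : S / (4 * K) * (4 * K) = S := by field_simp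
      nlinarith
    · rw [div_le_iff₀ (by positivity)]
      have : 0 ≤ S / (4 * K) := by positivity
      nlinarith
  -- the gradient bound `G⁻² |∇ log(ψ/G)|² ≤ κ'²` on `U`
  have hΛU : ∀ x ∈ U, (G x)⁻¹ ^ 2 * g.gradSq (fun y ↦ Real.log (ψ y / G y)) x ≤ κ' ^ 2 := by
    intro x hx
    have hGx := h0 x hx
    have hev : (fun y ↦ Real.log (ψ y / G y)) =ᶠ[𝓝 x] fun y ↦ Real.log (4 * K / (4 * K + G y)) := by
      filter_upwards [hUopen.mem_nhds hx] with y hy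
      rw [hratioU y hy]
    rw [gradSq_congr_of_eventuallyEq g hev, gradSq_log_ratio g hK hGx (hGd x (hUp x hx))]
    have hgr0 : 0 ≤ g.gradSq G x := g.gradSq_nonneg hg G x
    have hκ'sq : κ' ^ 2 = Λ / (16 * K ^ 2) := by
      rw [hκ', div_pow, Real.sq_sqrt hΛ0]; ring
    rw [hκ'sq]
    have hΛx := hΛ x (hUp x hx) (hUS x hx)
    have h4 : (4 * K + G x)⁻¹ ^ 2 ≤ (4 * K)⁻¹ ^ 2 := by
      have h4K : 0 < 4 * K := by positivity
      rw [inv_pow, inv_pow]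
      exact inv_anti₀ (by positivity) (pow_le_pow_left₀ h4K.le (by linarith) 2)
    calc (G x)⁻¹ ^ 2 * ((4 * K + G x)⁻¹ ^ 2 * g.gradSq G x)
        = (4 * K + G x)⁻¹ ^ 2 * ((G x)⁻¹ ^ 2 * g.gradSq G x) := by ring
      _ ≤ (4 * K)⁻¹ ^ 2 * Λ := mul_le_mul h4 hΛx (by positivity) (by positivity)
      _ = Λ / (16 * K ^ 2) := by field_simp; ring
  -- the curvature weights
  have hr : ∀ x ∈ U, 0 ≤ (fun _ : M ↦ (0 : ℝ)) x ∧ (fun _ : M ↦ (0 : ℝ)) x - 0 ≤ r₁ x := by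
    intro x _
    refine ⟨le_rfl, ?_⟩
    have : 0 < r₁ x := mul_pos (inv_pos.2 (pow_pos (hψpos x) 3)) (hLψ x)
    simp only [sub_zero]
    exact this.le
  -- the model clause on `U`: the blow-up clause
  have hmodel : ∀ τ' : ℝ, 0 < τ' → ∀ v : M → ℝ, ContMDiff (𝓡 4) 𝓘(ℝ, ℝ) ∞ v → tsupport v ⊆ U →
      ∫ x, (4 * Real.pi * τ') ^ (-(4 : ℝ) / 2) * (v x) ^ 2 * (G x) ^ 4
          ∂(riemannianMeasure (g.toContMDiffRiemannianMetric hg)) = 1 →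
        L ≤ ∫ x, (τ' * ((fun _ : M ↦ (0 : ℝ)) x * (v x) ^ 2 + 4 * ((G x)⁻¹ ^ 2 * g.gradSq v x))
            - (v x) ^ 2 * Real.log ((v x) ^ 2) - 4 * (v x) ^ 2)
            * ((4 * Real.pi * τ') ^ (-(4 : ℝ) / 2) * (G x) ^ 4)
          ∂(riemannianMeasure (g.toContMDiffRiemannianMetric hg)) := by
    intro τ' hτ' v hv hvsupp hvnorm
    have hvp : v =ᶠ[𝓝 p] 0 := notMem_tsupport_iff_eventuallyEq.mp fun h ↦ hpU (hvsupp h)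
    refine (hBlow τ' hτ' v hv hvp hvnorm).trans_eq ?_
    refine integral_congr_ae (ae_of_all _ fun x ↦ ?_)
    ring
  have key := wClause_weight_comparison M g hg U hUopen G ψ (fun _ ↦ 0) r₁ hφ₀ hφ₁ hr₀c hr₁c h0 h1
    κ κ' 0 hκ0 hκ'0 le_rfl hρ hΛU hr L hmodel τ ε hτ hε hε1 w hw hsupp hnorm
  exact key

end GluingCore

/-- **The core clause of the round-capped blow-up** (registered sub-goal `gluingCoreClause` of
Stub D of line `green-blowup-conformal-entropy`; ∀-form of `GluingCore.coreClause`): the blow-up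
clause at level `L` and the weight comparison H3 give the `ψ_K`-weighted clause on
`{x ≠ p, G x < S}` at level `L + 2 log(1−ε) − 8 log(1 + S/4K) − 16τ(1+S/4K)²(Λ/16K²)/ε`. [folklore] -/
theorem gluingCoreClause :
    ∀ (M : Type) [TopologicalSpace M] [T2Space M] [SecondCountableTopology M]
      [ChartedSpace (EuclideanSpace ℝ (Fin 4)) M] [IsManifold (𝓡 4) ∞ M] [CompactSpace M]
      [T3Space M] [MeasurableSpace M] [BorelSpace M]
      (g : PseudoRiemannianMetric (𝓡 4) ∞ (EuclideanSpace ℝ (Fin 4)) (TangentSpace (𝓡 4) : M → Type _))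
      [g.HasLeviCivita] (hg : g.IsRiemannian) (p : M) (G : M → ℝ),
      ContMDiffOn (𝓡 4) 𝓘(ℝ, ℝ) ∞ G {p}ᶜ → (∀ x, x ≠ p → 0 < G x) → ∀ (L : ℝ),
      (∀ τ : ℝ, 0 < τ → ∀ w : M → ℝ, ContMDiff (𝓡 4) 𝓘(ℝ, ℝ) ∞ w → w =ᶠ[𝓝 p] 0 →
        ∫ x, (4 * Real.pi * τ) ^ (-(4 : ℝ) / 2) * (w x) ^ 2 * (G x) ^ 4
            ∂(riemannianMeasure (g.toContMDiffRiemannianMetric hg)) = 1 →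
          L ≤ ∫ x, (4 * τ * ((G x)⁻¹ ^ 2 * g.gradSq w x) - (w x) ^ 2 * Real.log ((w x) ^ 2)
              - 4 * (w x) ^ 2) * ((4 * Real.pi * τ) ^ (-(4 : ℝ) / 2) * (G x) ^ 4)
            ∂(riemannianMeasure (g.toContMDiffRiemannianMetric hg))) →
      ∀ (K : ℝ), 0 < K → ∀ (ψ : M → ℝ), ContMDiff (𝓡 4) 𝓘(ℝ, ℝ) ∞ ψ → (∀ x, 0 < ψ x) →
      (∀ x, x ≠ p → ψ x = 4 * K * G x / (4 * K + G x)) →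
      (∀ x, 0 < g.scalarCurvature x * ψ x - 6 * g.dalembertian ψ x) →
      ∀ (S Λ : ℝ), 0 < S → 0 ≤ Λ → (∀ x, x ≠ p → G x < S → (G x)⁻¹ ^ 2 * g.gradSq G x ≤ Λ) →
      ∀ (τ ε : ℝ), 0 < τ → 0 < ε → ε < 1 →
      ∀ w : M → ℝ, ContMDiff (𝓡 4) 𝓘(ℝ, ℝ) ∞ w → tsupport w ⊆ {x | x ≠ p ∧ G x < S} →
        ∫ x, (4 * Real.pi * τ) ^ (-(4 : ℝ) / 2) * (w x) ^ 2 * (ψ x) ^ 4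
            ∂(riemannianMeasure (g.toContMDiffRiemannianMetric hg)) = 1 →
          L + 2 * Real.log (1 - ε) - 8 * Real.log (1 + S / (4 * K))
              - 16 * τ * Real.exp (2 * Real.log (1 + S / (4 * K))) * (Real.sqrt Λ / (4 * K)) ^ 2 / ε
              - τ * 0 ≤
            ∫ x, (τ * ((ψ x ^ 3)⁻¹ * (g.scalarCurvature x * ψ x - 6 * g.dalembertian ψ x) * (w x) ^ 2
                  + 4 * ((ψ x)⁻¹ ^ 2 * g.gradSq w x))
                - (w x) ^ 2 * Real.log ((w x) ^ 2) - 4 * (w x) ^ 2)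
                * ((4 * Real.pi * τ) ^ (-(4 : ℝ) / 2) * (ψ x) ^ 4)
              ∂(riemannianMeasure (g.toContMDiffRiemannianMetric hg)) := by
  intro M _ _ _ _ _ _ _ _ _ g _ hg p G hGs hGpos L hBlow K hK ψ hψ hψpos hψG hLψ S Λ hS hΛ0 hΛ
  exact GluingCore.coreClause g hg hGs hGpos hBlow hK hψ hψpos hψG hLψ hS hΛ0 hΛ

end Summit.SmoothPoincare4.SmoothPoincare4.Theorems

end
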